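import Mathlib
import HarnessLib
import Literature.AlgebraicGeometry.Resolution.QuadraticTransformsRegular

/-!
# Kollár–Szabó going down, (P1): the quadratic transform at a chart point is a regular local ring
# (crux `WildQuotients.WildQuotientResolution`, stub `stub_phaseZeroHighDim`)

Crux stmt-ResolutionOfSingularities-15640 (`WildQuotientResolution`), registered stub `stub_phaseZeroHighDim`; programme:
`KollarSzaboGoingDown_holds` via ✓`kollarSzaboGoingDown_of_localStepLE` with `X' = Spec R₁`, `R₁` the equivariant quadratic
transform of hand 8-g1 (✓`EigenlineChart.exists_equivariant_quadraticTransform`, built as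
`LocalSubring.ofPrime (blowupRing S (x i)) 𝔫`, ✓`isQuadraticTransform_ofPrime_blowupRing`). Item (P1) of the remaining
list (memo KS-GOINGDOWN-ASSEMBLY.md): REGULARITY of `R₁`, from the tree's ✓`isRegularRing_blowupRing` (Abhyankar 1959,
Lemma 3.20: the chart `S[𝔪/x_i]` of a regular local `S ⊆ K` is a regular ring) and Mathlib's `LocalSubring.ofPrimeEquiv`.

* `isRegularLocalRing_ofPrime` — `A_P ⊆ K` (`LocalSubring.ofPrime A P`) is a regular local ring for `A ⊆ K` a regular ring;
* `ringKrullDim_ofPrime_eq_height` — its dimension is `ht P`;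
* `isRegularLocalRing_ofPrime_blowupRing` — ★ every localisation `S[𝔪/x_i]_𝔫 ⊆ K` of the chart of the point blow-up of a
  regular local `S ⊆ K` at a prime `𝔫` is a regular local ring (in particular 8-g1's `R₁`).

[OURS · crux stmt-ResolutionOfSingularities-15640 · helper toward `stub_phaseZeroHighDim` ((P1) of the KS assembly; NOT a proof of the
stub); counted 0; AI-level work, weaker than expert review.] [cite: Abhyankar1959, Lemma 3.20]
-/

-- single-problem summit: the doubled namespace component `ResolutionOfSingularities` is forced
set_option linter.dupNamespace false

noncomputable section

open IsLocalRing Literature.AlgebraicGeometry.Resolution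

namespace Summit.ResolutionOfSingularities.ResolutionOfSingularities.Theorems.WildQuotientResolution.KSGoingDown

universe u

variable {K : Type u} [Field K]

/-- **`A_P ⊆ K` is a regular local ring when `A ⊆ K` is a regular ring** (`LocalSubring.ofPrime A P ≅ A_P`, Mathlib
`LocalSubring.ofPrimeEquiv`). [folklore] -/
theorem isRegularLocalRing_ofPrime (A : Subring K) [IsRegularRing A] (P : Ideal A) [P.IsPrime] :
    IsRegularLocalRing (LocalSubring.ofPrime A P).toSubring :=
  IsRegularLocalRing.of_ringEquiv (LocalSubring.ofPrimeEquiv A P).toRingEquiv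

omit [Field K] in
/-- **`dim A_P = ht P`** for the local subring `LocalSubring.ofPrime A P ⊆ K`. [folklore] -/
theorem ringKrullDim_ofPrime_eq_height [Field K] (A : Subring K) (P : Ideal A) [P.IsPrime] :
    ringKrullDim (LocalSubring.ofPrime A P).toSubring = P.height :=
  IsLocalization.AtPrime.ringKrullDim_eq_height P _

/-- ★ **The localisations of the chart of the point blow-up of a regular local ring are regular**: for `S ⊆ K` regular
local, `x` a regular system of parameters, `x_i ≠ 0`, and any prime `𝔫` of `S[𝔪/x_i]`, the local ring
`S[𝔪/x_i]_𝔫 ⊆ K` (`LocalSubring.ofPrime`) is a regular local ring — in particular the equivariant quadratic transform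
`R₁` of ✓`EigenlineChart.exists_equivariant_quadraticTransform`. [cite: Abhyankar1959, Lemma 3.20] -/
theorem isRegularLocalRing_ofPrime_blowupRing (S : Subring K) [IsRegularLocalRing S] {d : ℕ}
    (hd : (maximalIdeal S).spanFinrank = d) (x : Fin d → S)
    (hx : Ideal.span (Set.range x) = maximalIdeal S) (i : Fin d)
    (𝔫 : Ideal (blowupRing S (x i : K))) [𝔫.IsPrime] :
    IsRegularLocalRing (LocalSubring.ofPrime (blowupRing S (x i : K)) 𝔫).toSubring := by
  haveI : IsRegularRing (blowupRing S (x i : K)) := isRegularRing_blowupRing S hd x hx i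
  exact isRegularLocalRing_ofPrime _ 𝔫

end Summit.ResolutionOfSingularities.ResolutionOfSingularities.Theorems.WildQuotientResolution.KSGoingDown

end
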